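import Literature.NumberTheory.LFunctions.Zhang2022.EllFirstOrderBox
import HarnessLib

/-!
# Zhang (2022), B-ell first-order reading: the `K₀` test #1 in PLANE form — `2×2` Hermitian PSD ⇔ every design
# in `span_ℂ{k₁+k₂, k₂+k₃}`; corner / one-sided tests in matrix form; the certified v0.1 data of record
# (cell `landau-siegel`, family B-ell; theorems only)

Topic `Literature/NumberTheory/LFunctions/Zhang2022` (Landau–Siegel audit tree; verdict-neutral).
Y. Zhang, arXiv:2211.02515v1 (2022) [Zhang2022LandauSiegel] is an unrefereed manuscript under
adjudication; NOTHING here asserts or denies its Theorems 1–2 and nothing here is a claim about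
Landau–Siegel zeros.  Theorems only (no `def`, no `notation`), over ls-Bell-typer-1's SET-form first-order
vocabulary `EllRegime.firstOrderValue / ModelConsistentOn / ClosesFirstOrderOn` (`EllRegimeStatements` Part 6).

WHY (REF-B2 21:18:07Z (r2), ADOPTED ls-Bell-plan 21:21:27Z (r1)–(r4); r1 CLOSED REF-B2 22:17:54Z).  The `K₀` sub-family
of record is the complex PLANE `K₀ ∩ {u(1) = 0} = span_ℂ{e₁ = k₁+k₂, e₂ = k₂+k₃}` (`ι ∈ ℂ²` free), not three named
vectors.  Each first-order coefficient `X ∈ {gain, G₀, G₁, G₂}` is a Hermitian form on the plane, `X(u) = ιᴴ·X·ι` for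
`u = ι₁e₁ + ι₂e₂`, `X = [[a, z],[z̄, b]]`, i.e. `X(u) = a|ι₁|² + b|ι₂|² + 2·Re(z·ῑ₁·ι₂)`; the first-order value at
the datum `p = (λ, c′)` is `ιᴴ·H(p)·ι` with `H(p) = gain + G₀ + λG₁ + c′G₂`, which in typer-1's scalar vocabulary is
`firstOrderValue (gain(u)) (G₀(u)) (G₁(u)) (G₂(u)) p` (`plane_firstOrderValue`).  Hence
  test #1 on the plane over `𝓜`  ⇔  `∀ u ∈ plane, ModelConsistentOn 𝓜 (gain(u)) (G₀(u)) (G₁(u)) (G₂(u))`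
                                   ⇔  `∀ p ∈ 𝓜, H(p) ⪰ 0` (2×2 PSD: `a ≥ 0 ∧ b ≥ 0 ∧ |z|² ≤ ab` ⇔ `tr ≥ 0 ∧ det ≥ 0`).

CONTENT.
§1 `2×2` Hermitian algebra: `herm2_re_coord` (coordinates), `herm2_nonneg_of_psd` (PSD ⇒ every `ι` gives `≥ 0`;
   SOS certificate `a·value = |aι₁ + zι₂|² + (ab − |z|²)|ι₂|²`), `herm2_psd_of_forall_nonneg` (converse, explicit
   witnesses), `herm2_forall_nonneg_iff_psd`, `herm2_psd_iff_trace_det`, real-entry forms `herm2Real_*`.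
§2 plane tests: `plane_firstOrderValue`; `modelConsistentOn_plane_box_of_corners` (PSD at the four corners of
   `[l₁,l₂]×[c₁,c₂]` ⇒ test #1 for every `u` in the plane — `{H ⪰ 0}` is convex); `firstOrderValue_oneSided_ge_gain`,
   `modelConsistentOn_halfStrip_of_ends`, `modelConsistentOn_plane_oneSided` (deriv-1's ONE-SIDED `𝓜 = [l₁,0] × [c₁,∞)`:
   `−G₁ ⪰ 0 ∧ G₂ ⪰ 0 ∧ H(0,c₁) ⪰ 0` suffice); `exists_not_modelConsistentOn_plane_of_not_psd` (the test is DECISIVE: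
   a non-PSD `H(p)` at some `p ∈ 𝓜` produces a plane design failing test #1).
§3 THE DATA OF RECORD (derivation currency; ls-Bell-deriv-1 `D-ELL-1-K0.md` v0.1 sha16 `c639fc46be0504c8` §4/§8 + the
   plane polarisation, TWO-LINEAGE certified 128/128 (ls-ref-num 22:15:24Z; obj-eng-1 j261041/j261098, Bell-num-2
   j261037/j261103, Bell-num-1 j261113, Blen-num-1 K0FO2-A j260895; REF-B2 r1 CLOSED 22:17:54Z): basis `(e₁, e₂)`,
   `S := [[1,−1],[−1,1]]`, all atoms REAL symmetric (Im-crosses `= 0` certified):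
     gain `= 0` on the plane (frame of record: one piece, `L_M` units; `F_{b₀} ≡ 0` on `K₀`),
     `G₀ = −πτ₀·Φ`, `Φ = 4S`;   `G₁ = −32π·S`;   `G₂ = π²·D`, `D = [[176,16],[16,48]]`;
     `𝓜 = [l₁, 0] × [c′_det(τ₀), ∞)`, `c′_det(τ₀) = (1+τ₀)/(2π)` (λ ONE-SIDED, deriv-1 §6), `τ₀ ≥ 0`.
   Typed: `k0Plane_S_value` (`S(u) = |ι₁ − ι₂|²`), `k0Plane_modelCorner` (`H(0, c′_det) = π([[88,8],[8,24]] +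
   τ₀[[84,12],[12,20]])` as a value identity — obj-eng-1's certificate matrices `(tr,det) = (112, 2048)`, `(104, 1536)`),
   **`modelConsistentOn_k0Plane`** (test #1 PASSES on the whole plane for every `τ₀ ≥ 0`, every `l₁`),
   `k0Plane_inf` (inf over `𝓜` = the model-corner form), `modelConsistentOn_k0Plane_symm` (crude symmetric box
   `|λ| ≤ ½`: still PSD; corner `λ = +½` at `τ₀ = 0` is `π[[72,24],[24,8]]`, `det = 0`), and the SHARPNESS facts
   `k0Plane_sheet0_symmCorner_null` (the null design `ι = (1, −3)`, i.e. `u = k₁ − 2k₂ − 3k₃`, has value `0` there) and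
   `not_modelConsistentOn_k0Plane_symm_of_gt_half` (any symmetric box `|λ| ≤ Λ` with `Λ > ½` FAILS on the plane at
   `τ₀ = 0` — the three named vectors do not see this: their symmetric margins are `(32, 72, 8)π`).
   The kernel states exact facts about the displayed affine matrix pencil; that these matrices ARE the first-order
   coefficients of `Ξ_I` is deriv-1's derivation (HEUR until ls-theory reviews), not asserted here.

## References
* Y. Zhang, arXiv:2211.02515v1 (2022), §2 (2.13), Lemma 2.3 (2.15)–(2.16), (2.32)–(2.33); §7 (7.18)–(7.21);
  §8 Lemmas 8.2–8.4. [Zhang2022LandauSiegel]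

«The programme SEARCHES and TYPES; no claim about Landau–Siegel zeros, Theorems 1–2 of arXiv:2211.02515 or
a repaired Margin232 until a kernel theorem says so.»
-/

noncomputable section

open Real Set
open scoped ComplexConjugate

namespace Literature.NumberTheory.LFunctions.Zhang2022.EllRegime

/-! ## §1 `2×2` Hermitian forms `[[a, z],[z̄, b]]` evaluated at `ι = (ι₁, ι₂) ∈ ℂ²` -/

/-- Coordinates of the cross term: `Re(z·ῑ₁·ι₂) = x(p r + q s) − y(p s − q r)` for `z = x+iy`, `ι₁ = p+iq`, `ι₂ = r+is`.
[cite: Zhang2022LandauSiegel, §2 (2.32)] -/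
theorem herm2_re_coord (z ι₁ ι₂ : ℂ) :
    (z * conj ι₁ * ι₂).re =
      z.re * (ι₁.re * ι₂.re + ι₁.im * ι₂.im) - z.im * (ι₁.re * ι₂.im - ι₁.im * ι₂.re) := by
  simp only [Complex.mul_re, Complex.mul_im, Complex.conj_re, Complex.conj_im]
  ring

/-- **PSD ⇒ non-negative on every design of the plane.**  If `a ≥ 0`, `b ≥ 0` and `|z|² ≤ ab` then
`a|ι₁|² + b|ι₂|² + 2Re(z ῑ₁ ι₂) ≥ 0` for all `ι ∈ ℂ²` (certificate: `a·value = |aι₁ + zι₂|² + (ab − |z|²)|ι₂|²`).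
[cite: Zhang2022LandauSiegel, §2 Lemma 2.3, (2.32)] -/
theorem herm2_nonneg_of_psd {a b : ℝ} {z : ℂ} (ha : 0 ≤ a) (hb : 0 ≤ b) (hdet : Complex.normSq z ≤ a * b)
    (ι₁ ι₂ : ℂ) : 0 ≤ a * Complex.normSq ι₁ + b * Complex.normSq ι₂ + 2 * (z * conj ι₁ * ι₂).re := by
  rw [herm2_re_coord]
  rw [Complex.normSq_apply] at hdet
  simp only [Complex.normSq_apply]
  set p := ι₁.re; set q := ι₁.im; set r := ι₂.re; set s := ι₂.im; set x := z.re; set y := z.im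
  have hrs : 0 ≤ r * r + s * s := by nlinarith
  have hpq : 0 ≤ p * p + q * q := by nlinarith
  rcases ha.eq_or_lt with h0 | hpos
  · -- `a = 0` forces `z = 0`
    have hx : x = 0 := by nlinarith
    have hy : y = 0 := by nlinarith
    rw [hx, hy, ← h0]
    nlinarith [mul_nonneg hb hrs]
  · have key : a * (a * (p * p + q * q) + b * (r * r + s * s) +
        2 * (x * (p * r + q * s) - y * (p * s - q * r))) =
        (a * p + x * r - y * s) ^ 2 + (a * q + x * s + y * r) ^ 2 + (a * b - (x * x + y * y)) * (r * r + s * s) := by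
      ring
    have hnn : 0 ≤ a * (a * (p * p + q * q) + b * (r * r + s * s) +
        2 * (x * (p * r + q * s) - y * (p * s - q * r))) := by
      rw [key]
      have : 0 ≤ (a * b - (x * x + y * y)) * (r * r + s * s) := mul_nonneg (by linarith) hrs
      positivity
    exact (mul_nonneg_iff_of_pos_left hpos).mp hnn

/-- **Converse: non-negative on every design ⇒ PSD** (witnesses: `ι = (1,0)`, `(0,1)`, and `(1, −t·z̄)` with
`t = 1/b` or `t = (a+1)/(2|z|²)`). [cite: Zhang2022LandauSiegel, §2 Lemma 2.3, (2.32)] -/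
theorem herm2_psd_of_forall_nonneg {a b : ℝ} {z : ℂ}
    (h : ∀ ι₁ ι₂ : ℂ, 0 ≤ a * Complex.normSq ι₁ + b * Complex.normSq ι₂ + 2 * (z * conj ι₁ * ι₂).re) :
    0 ≤ a ∧ 0 ≤ b ∧ Complex.normSq z ≤ a * b := by
  have ha : 0 ≤ a := by simpa using h 1 0
  have hb : 0 ≤ b := by simpa using h 0 1
  refine ⟨ha, hb, ?_⟩
  by_contra hlt
  push Not at hlt
  have hz : 0 < Complex.normSq z := lt_of_le_of_lt (mul_nonneg ha hb) hlt
  -- the test designs `ι = (1, −t·z̄)`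
  have hval : ∀ t : ℝ, 0 ≤ a + b * (t ^ 2 * Complex.normSq z) - 2 * (t * Complex.normSq z) := by
    intro t
    have h1 := h 1 (-(t : ℂ) * conj z)
    have e1 : Complex.normSq (-(t : ℂ) * conj z) = t ^ 2 * Complex.normSq z := by
      rw [Complex.normSq_mul, Complex.normSq_neg, Complex.normSq_ofReal, Complex.normSq_conj]; ring
    have e2 : (z * conj (1 : ℂ) * (-(t : ℂ) * conj z)).re = -(t * Complex.normSq z) := by
      have : z * conj (1 : ℂ) * (-(t : ℂ) * conj z) = -((t : ℂ) * (z * conj z)) := by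
        rw [map_one]; ring
      rw [this, Complex.mul_conj, Complex.neg_re, ← Complex.ofReal_mul, Complex.ofReal_re]
    rw [Complex.normSq_one, e1, e2] at h1
    linarith
  rcases hb.eq_or_lt with hb0 | hbpos
  · have h2 := hval ((a + 1) / (2 * Complex.normSq z))
    have e : 2 * ((a + 1) / (2 * Complex.normSq z) * Complex.normSq z) = a + 1 := by
      field_simp
    rw [← hb0, zero_mul, add_zero, e] at h2
    linarith
  · have h2 := hval (1 / b)
    have e : a + b * ((1 / b) ^ 2 * Complex.normSq z) - 2 * (1 / b * Complex.normSq z) =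
        (a * b - Complex.normSq z) / b := by
      field_simp; ring
    rw [e] at h2
    have h3 : (a * b - Complex.normSq z) / b < 0 := div_neg_of_neg_of_pos (by linarith) hbpos
    linarith

/-- **PSD ⇔ non-negative on every design.** [cite: Zhang2022LandauSiegel, §2 Lemma 2.3, (2.32)] -/
theorem herm2_forall_nonneg_iff_psd (a b : ℝ) (z : ℂ) :
    (∀ ι₁ ι₂ : ℂ, 0 ≤ a * Complex.normSq ι₁ + b * Complex.normSq ι₂ + 2 * (z * conj ι₁ * ι₂).re) ↔
      (0 ≤ a ∧ 0 ≤ b ∧ Complex.normSq z ≤ a * b) :=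
  ⟨herm2_psd_of_forall_nonneg, fun h => herm2_nonneg_of_psd h.1 h.2.1 h.2.2⟩

/-- **`2×2` PSD via trace and determinant** (REF-B2 (r2): «trace ≥ 0 ∧ det ≥ 0»): for `d = |z|² ≥ 0`,
`(a ≥ 0 ∧ b ≥ 0 ∧ d ≤ ab) ⇔ (a + b ≥ 0 ∧ d ≤ ab)`. [cite: Zhang2022LandauSiegel, §2 (2.32)] -/
theorem herm2_psd_iff_trace_det {a b d : ℝ} (hd : 0 ≤ d) :
    (0 ≤ a ∧ 0 ≤ b ∧ d ≤ a * b) ↔ (0 ≤ a + b ∧ d ≤ a * b) := by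
  constructor
  · rintro ⟨ha, hb, h⟩; exact ⟨by linarith, h⟩
  · rintro ⟨ht, h⟩
    have hab : 0 ≤ a * b := hd.trans h
    refine ⟨?_, ?_, h⟩
    · by_contra ha; push Not at ha; nlinarith
    · by_contra hb; push Not at hb; nlinarith

/-- Real off-diagonal entry: `Re(x·ῑ₁·ι₂) = x·Re(ῑ₁ι₂)`. [cite: Zhang2022LandauSiegel, §2 (2.32)] -/
theorem herm2Real_re (x : ℝ) (ι₁ ι₂ : ℂ) : ((x : ℂ) * conj ι₁ * ι₂).re = x * (conj ι₁ * ι₂).re := by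
  rw [mul_assoc, Complex.re_ofReal_mul]

/-- **Real-symmetric `[[a, x],[x, b]]`: PSD ⇒ non-negative on every complex design.**
[cite: Zhang2022LandauSiegel, §2 Lemma 2.3, (2.32)] -/
theorem herm2Real_nonneg_of_psd {a b x : ℝ} (ha : 0 ≤ a) (hb : 0 ≤ b) (hdet : x ^ 2 ≤ a * b) (ι₁ ι₂ : ℂ) :
    0 ≤ a * Complex.normSq ι₁ + b * Complex.normSq ι₂ + 2 * x * (conj ι₁ * ι₂).re := by
  have h := herm2_nonneg_of_psd ha hb (z := (x : ℂ)) (by rw [Complex.normSq_ofReal]; nlinarith) ι₁ ι₂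
  rw [herm2Real_re] at h
  linarith

/-- **Real-symmetric converse.** [cite: Zhang2022LandauSiegel, §2 Lemma 2.3, (2.32)] -/
theorem herm2Real_psd_of_forall_nonneg {a b x : ℝ}
    (h : ∀ ι₁ ι₂ : ℂ, 0 ≤ a * Complex.normSq ι₁ + b * Complex.normSq ι₂ + 2 * x * (conj ι₁ * ι₂).re) :
    0 ≤ a ∧ 0 ≤ b ∧ x ^ 2 ≤ a * b := by
  have h' : ∀ ι₁ ι₂ : ℂ, 0 ≤ a * Complex.normSq ι₁ + b * Complex.normSq ι₂ + 2 * ((x : ℂ) * conj ι₁ * ι₂).re := by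
    intro ι₁ ι₂; have := h ι₁ ι₂; rw [herm2Real_re]; linarith
  obtain ⟨ha, hb, hd⟩ := herm2_psd_of_forall_nonneg h'
  rw [Complex.normSq_ofReal] at hd
  exact ⟨ha, hb, by nlinarith⟩

/-! ## §2 The plane tests: the value at `ι` of the pencil `H(λ,c′) = gain + G₀ + λG₁ + c′G₂` is `firstOrderValue` -/

/-- **The plane value is typer-1's `firstOrderValue` of the per-matrix values** (real-symmetric atoms
`gain = [[a, x],[x, b]]`, `G₀ = [[a₀, x₀],[x₀, b₀]]`, `G₁`, `G₂` likewise). [cite: Zhang2022LandauSiegel, §2 (2.32)] -/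
theorem plane_firstOrderValue (a b x a₀ b₀ x₀ a₁ b₁ x₁ a₂ b₂ x₂ lam c : ℝ) (ι₁ ι₂ : ℂ) :
    (a + a₀ + lam * a₁ + c * a₂) * Complex.normSq ι₁ + (b + b₀ + lam * b₁ + c * b₂) * Complex.normSq ι₂ +
        2 * (x + x₀ + lam * x₁ + c * x₂) * (conj ι₁ * ι₂).re =
      firstOrderValue (a * Complex.normSq ι₁ + b * Complex.normSq ι₂ + 2 * x * (conj ι₁ * ι₂).re)
        (a₀ * Complex.normSq ι₁ + b₀ * Complex.normSq ι₂ + 2 * x₀ * (conj ι₁ * ι₂).re)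
        (a₁ * Complex.normSq ι₁ + b₁ * Complex.normSq ι₂ + 2 * x₁ * (conj ι₁ * ι₂).re)
        (a₂ * Complex.normSq ι₁ + b₂ * Complex.normSq ι₂ + 2 * x₂ * (conj ι₁ * ι₂).re) (lam, c) := by
  simp only [firstOrderValue]; ring

/-- **Corner test in matrix form** (REF-B2 (r2): «the corner test survives with PSD for ≥ 0»): if the pencil
`H(λ, c′) = gain + G₀ + λG₁ + c′G₂` is PSD at the four corners of `[l₁,l₂] × [c₁,c₂]`, then EVERY design `ι` of the
plane is model-consistent on the box. [cite: Zhang2022LandauSiegel, §2 Lemma 2.3, (2.15), (2.32)] -/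
theorem modelConsistentOn_plane_box_of_corners {a b x a₀ b₀ x₀ a₁ b₁ x₁ a₂ b₂ x₂ l₁ l₂ c₁ c₂ : ℝ}
    (h : ∀ lam c : ℝ, (lam = l₁ ∨ lam = l₂) → (c = c₁ ∨ c = c₂) →
      0 ≤ a + a₀ + lam * a₁ + c * a₂ ∧ 0 ≤ b + b₀ + lam * b₁ + c * b₂ ∧
        (x + x₀ + lam * x₁ + c * x₂) ^ 2 ≤ (a + a₀ + lam * a₁ + c * a₂) * (b + b₀ + lam * b₁ + c * b₂))
    (ι₁ ι₂ : ℂ) :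
    ModelConsistentOn (Icc l₁ l₂ ×ˢ Icc c₁ c₂)
      (a * Complex.normSq ι₁ + b * Complex.normSq ι₂ + 2 * x * (conj ι₁ * ι₂).re)
      (a₀ * Complex.normSq ι₁ + b₀ * Complex.normSq ι₂ + 2 * x₀ * (conj ι₁ * ι₂).re)
      (a₁ * Complex.normSq ι₁ + b₁ * Complex.normSq ι₂ + 2 * x₁ * (conj ι₁ * ι₂).re)
      (a₂ * Complex.normSq ι₁ + b₂ * Complex.normSq ι₂ + 2 * x₂ * (conj ι₁ * ι₂).re) := by
  have corner : ∀ lam c : ℝ, (lam = l₁ ∨ lam = l₂) → (c = c₁ ∨ c = c₂) →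
      0 ≤ firstOrderValue (a * Complex.normSq ι₁ + b * Complex.normSq ι₂ + 2 * x * (conj ι₁ * ι₂).re)
        (a₀ * Complex.normSq ι₁ + b₀ * Complex.normSq ι₂ + 2 * x₀ * (conj ι₁ * ι₂).re)
        (a₁ * Complex.normSq ι₁ + b₁ * Complex.normSq ι₂ + 2 * x₁ * (conj ι₁ * ι₂).re)
        (a₂ * Complex.normSq ι₁ + b₂ * Complex.normSq ι₂ + 2 * x₂ * (conj ι₁ * ι₂).re) (lam, c) := by
    intro lam c hl hc
    obtain ⟨h1, h2, h3⟩ := h lam c hl hc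
    rw [← plane_firstOrderValue]
    exact herm2Real_nonneg_of_psd h1 h2 h3 ι₁ ι₂
  exact modelConsistentOn_box_of_corners (corner l₁ c₁ (Or.inl rfl) (Or.inl rfl))
    (corner l₁ c₂ (Or.inl rfl) (Or.inr rfl)) (corner l₂ c₁ (Or.inr rfl) (Or.inl rfl))
    (corner l₂ c₂ (Or.inr rfl) (Or.inr rfl))

/-- **One-sided `λ`-box, scalar, with a gain slot**: `G₁ ≤ 0`, `G₂ ≥ 0` ⇒ on `[l₁, 0] × [c₁, ∞)` the value is
`≥ gain + G₀ + c₁G₂` (its value at the model corner `(0, c₁)`). [cite: Zhang2022LandauSiegel, §2 Lemma 2.3, (2.32)] -/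
theorem firstOrderValue_oneSided_ge_gain {gain G₀ G₁ G₂ l₁ c₁ : ℝ} (hG₁ : G₁ ≤ 0) (hG₂ : 0 ≤ G₂) :
    ∀ p ∈ Icc l₁ 0 ×ˢ Ici c₁, gain + G₀ + c₁ * G₂ ≤ firstOrderValue gain G₀ G₁ G₂ p := by
  rintro ⟨lam, c⟩ ⟨⟨_, hl⟩, hc⟩
  simp only [firstOrderValue, mem_Ici] at hc ⊢
  have h1 : 0 ≤ lam * G₁ := mul_nonneg_of_nonpos_of_nonpos hl hG₁
  have h2 : c₁ * G₂ ≤ c * G₂ := mul_le_mul_of_nonneg_right hc hG₂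
  linarith

/-- **Half-strip with a two-sided `λ`-range, scalar**: `G₂ ≥ 0` and the value `≥ 0` at the two bottom corners
`(l₁, c₁)`, `(l₂, c₁)` ⇒ model-consistent on `[l₁, l₂] × [c₁, ∞)`. [cite: Zhang2022LandauSiegel, §2 Lemma 2.3, (2.32)] -/
theorem modelConsistentOn_halfStrip_of_ends {gain G₀ G₁ G₂ l₁ l₂ c₁ : ℝ} (hG₂ : 0 ≤ G₂)
    (v₁ : 0 ≤ firstOrderValue gain G₀ G₁ G₂ (l₁, c₁)) (v₂ : 0 ≤ firstOrderValue gain G₀ G₁ G₂ (l₂, c₁)) :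
    ModelConsistentOn (Icc l₁ l₂ ×ˢ Ici c₁) gain G₀ G₁ G₂ := by
  rintro ⟨lam, c⟩ ⟨⟨hl₁, hl₂⟩, hc⟩
  simp only [mem_Ici] at hc
  have hbot := firstOrderValue_nonneg_of_ends_fst hl₁ hl₂ v₁ v₂
  have e : firstOrderValue gain G₀ G₁ G₂ (lam, c) =
      firstOrderValue gain G₀ G₁ G₂ (lam, c₁) + (c - c₁) * G₂ := by
    simp only [firstOrderValue]; ring
  rw [e]
  have : 0 ≤ (c - c₁) * G₂ := mul_nonneg (by linarith) hG₂
  linarith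

/-- **One-sided test in matrix form** (deriv-1's `𝓜 = [l₁, 0] × [c₁, ∞)`): if `−G₁ ⪰ 0`, `G₂ ⪰ 0` and the model-corner
matrix `gain + G₀ + c₁G₂ ⪰ 0` (real-symmetric PSD criteria), then every design of the plane is model-consistent on `𝓜`.
[cite: Zhang2022LandauSiegel, §2 Lemma 2.3, (2.15), (2.32)] -/
theorem modelConsistentOn_plane_oneSided {a b x a₀ b₀ x₀ a₁ b₁ x₁ a₂ b₂ x₂ c₁ : ℝ} (l₁ : ℝ)
    (h₁ : 0 ≤ -a₁ ∧ 0 ≤ -b₁ ∧ x₁ ^ 2 ≤ a₁ * b₁) (h₂ : 0 ≤ a₂ ∧ 0 ≤ b₂ ∧ x₂ ^ 2 ≤ a₂ * b₂)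
    (h₀ : 0 ≤ a + a₀ + c₁ * a₂ ∧ 0 ≤ b + b₀ + c₁ * b₂ ∧
      (x + x₀ + c₁ * x₂) ^ 2 ≤ (a + a₀ + c₁ * a₂) * (b + b₀ + c₁ * b₂)) (ι₁ ι₂ : ℂ) :
    ModelConsistentOn (Icc l₁ 0 ×ˢ Ici c₁)
      (a * Complex.normSq ι₁ + b * Complex.normSq ι₂ + 2 * x * (conj ι₁ * ι₂).re)
      (a₀ * Complex.normSq ι₁ + b₀ * Complex.normSq ι₂ + 2 * x₀ * (conj ι₁ * ι₂).re)
      (a₁ * Complex.normSq ι₁ + b₁ * Complex.normSq ι₂ + 2 * x₁ * (conj ι₁ * ι₂).re)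
      (a₂ * Complex.normSq ι₁ + b₂ * Complex.normSq ι₂ + 2 * x₂ * (conj ι₁ * ι₂).re) := by
  have hG₁ : a₁ * Complex.normSq ι₁ + b₁ * Complex.normSq ι₂ + 2 * x₁ * (conj ι₁ * ι₂).re ≤ 0 := by
    have := herm2Real_nonneg_of_psd h₁.1 h₁.2.1 (x := -x₁) (by nlinarith [h₁.2.2]) ι₁ ι₂
    linarith
  have hG₂ := herm2Real_nonneg_of_psd h₂.1 h₂.2.1 h₂.2.2 ι₁ ι₂
  have hcorner := herm2Real_nonneg_of_psd h₀.1 h₀.2.1 h₀.2.2 ι₁ ι₂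
  intro p hp
  refine le_trans ?_ (firstOrderValue_oneSided_ge_gain hG₁ hG₂ p hp)
  nlinarith [hcorner]

/-- **The plane test is DECISIVE**: if at some datum `(λ, c′) ∈ 𝓜` the matrix `H(λ, c′)` is NOT PSD, some design of
the plane FAILS test #1 on `𝓜`. [cite: Zhang2022LandauSiegel, §2 Lemma 2.3, (2.32)] -/
theorem exists_not_modelConsistentOn_plane_of_not_psd {a b x a₀ b₀ x₀ a₁ b₁ x₁ a₂ b₂ x₂ lam c : ℝ}
    {𝓜 : Set (ℝ × ℝ)} (hp : (lam, c) ∈ 𝓜)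
    (h : ¬ (0 ≤ a + a₀ + lam * a₁ + c * a₂ ∧ 0 ≤ b + b₀ + lam * b₁ + c * b₂ ∧
      (x + x₀ + lam * x₁ + c * x₂) ^ 2 ≤ (a + a₀ + lam * a₁ + c * a₂) * (b + b₀ + lam * b₁ + c * b₂))) :
    ∃ ι₁ ι₂ : ℂ, ¬ ModelConsistentOn 𝓜
      (a * Complex.normSq ι₁ + b * Complex.normSq ι₂ + 2 * x * (conj ι₁ * ι₂).re)
      (a₀ * Complex.normSq ι₁ + b₀ * Complex.normSq ι₂ + 2 * x₀ * (conj ι₁ * ι₂).re)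
      (a₁ * Complex.normSq ι₁ + b₁ * Complex.normSq ι₂ + 2 * x₁ * (conj ι₁ * ι₂).re)
      (a₂ * Complex.normSq ι₁ + b₂ * Complex.normSq ι₂ + 2 * x₂ * (conj ι₁ * ι₂).re) := by
  by_contra hall
  push Not at hall
  apply h
  apply herm2Real_psd_of_forall_nonneg
  intro ι₁ ι₂
  rw [plane_firstOrderValue]
  exact hall ι₁ ι₂ (lam, c) hp

/-! ## §3 The `K₀` plane data of record (D-ELL-1-K0 v0.1; two-lineage 128/128) -/

/-- The matrix `S = [[1,−1],[−1,1]]` evaluates to `|ι₁ − ι₂|²` (so `Φ = 4S` and `−G₁ = 32π·S` are `⪰ 0`, rank one,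
null along `u* = e₁ + e₂ = k₁+2k₂+k₃`). [cite: Zhang2022LandauSiegel, §2 (2.32)] -/
theorem k0Plane_S_value (ι₁ ι₂ : ℂ) :
    1 * Complex.normSq ι₁ + 1 * Complex.normSq ι₂ + 2 * (-1) * (conj ι₁ * ι₂).re = Complex.normSq (ι₁ - ι₂) := by
  rw [Complex.normSq_sub]
  have : (ι₁ * conj ι₂).re = (conj ι₁ * ι₂).re := by
    rw [← Complex.conj_re (ι₁ * conj ι₂), map_mul, Complex.conj_conj, mul_comm]
  rw [this]; ring

/-- **The model-corner form** `H(0, c′_det(τ₀)) = −πτ₀Φ + c′_det·π²D = π·([[88,8],[8,24]] + τ₀·[[84,12],[12,20]])`,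
as an identity of values (obj-eng-1 22:06:36Z certificate matrices). [cite: Zhang2022LandauSiegel, §2 (2.13), (2.32)] -/
theorem k0Plane_modelCorner (τ₀ : ℝ) (ι₁ ι₂ : ℂ) :
    firstOrderValue 0
        (-(4 * τ₀ * π) * Complex.normSq ι₁ + -(4 * τ₀ * π) * Complex.normSq ι₂ + 2 * (4 * τ₀ * π) * (conj ι₁ * ι₂).re)
        (-(32 * π) * Complex.normSq ι₁ + -(32 * π) * Complex.normSq ι₂ + 2 * (32 * π) * (conj ι₁ * ι₂).re)
        (176 * π ^ 2 * Complex.normSq ι₁ + 48 * π ^ 2 * Complex.normSq ι₂ + 2 * (16 * π ^ 2) * (conj ι₁ * ι₂).re)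
        (0, (1 + τ₀) / (2 * π)) =
      π * ((88 * Complex.normSq ι₁ + 24 * Complex.normSq ι₂ + 2 * 8 * (conj ι₁ * ι₂).re) +
        τ₀ * (84 * Complex.normSq ι₁ + 20 * Complex.normSq ι₂ + 2 * 12 * (conj ι₁ * ι₂).re)) := by
  simp only [firstOrderValue]
  field_simp
  ring

/-- **`K₀` TEST #1 IN PLANE FORM PASSES** (every `τ₀ ≥ 0`, every `l₁`): with the v0.1 atoms of record
(`gain = 0`, `G₀ = −4πτ₀S`, `G₁ = −32πS`, `G₂ = π²D`), every design `ι ∈ ℂ²` of `span_ℂ{k₁+k₂, k₂+k₃}` is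
model-consistent on `𝓜 = [l₁, 0] × [c′_det(τ₀), ∞)`.  (`−G₁ = 32πS ⪰ 0`, `D ≻ 0` (`16² ≤ 176·48`), model corner
`[[88,8],[8,24]] + τ₀[[84,12],[12,20]]`, both summands PSD.) [cite: Zhang2022LandauSiegel, §2 Lemma 2.3, (2.13), (2.15), (2.32)] -/
theorem modelConsistentOn_k0Plane {τ₀ : ℝ} (l₁ : ℝ) (hτ : 0 ≤ τ₀) (ι₁ ι₂ : ℂ) :
    ModelConsistentOn (Icc l₁ 0 ×ˢ Ici ((1 + τ₀) / (2 * π))) 0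
      (-(4 * τ₀ * π) * Complex.normSq ι₁ + -(4 * τ₀ * π) * Complex.normSq ι₂ + 2 * (4 * τ₀ * π) * (conj ι₁ * ι₂).re)
      (-(32 * π) * Complex.normSq ι₁ + -(32 * π) * Complex.normSq ι₂ + 2 * (32 * π) * (conj ι₁ * ι₂).re)
      (176 * π ^ 2 * Complex.normSq ι₁ + 48 * π ^ 2 * Complex.normSq ι₂ + 2 * (16 * π ^ 2) * (conj ι₁ * ι₂).re) := by
  have hS := k0Plane_S_value ι₁ ι₂
  have hSnn : 0 ≤ Complex.normSq (ι₁ - ι₂) := Complex.normSq_nonneg _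
  have hG₁ : -(32 * π) * Complex.normSq ι₁ + -(32 * π) * Complex.normSq ι₂ + 2 * (32 * π) * (conj ι₁ * ι₂).re ≤ 0 := by
    nlinarith [pi_pos]
  have hG₂ : 0 ≤ 176 * π ^ 2 * Complex.normSq ι₁ + 48 * π ^ 2 * Complex.normSq ι₂ +
      2 * (16 * π ^ 2) * (conj ι₁ * ι₂).re := by
    have := herm2Real_nonneg_of_psd (a := 176) (b := 48) (x := 16) (by norm_num) (by norm_num) (by norm_num) ι₁ ι₂
    have hπ : 0 < π ^ 2 := by positivity
    nlinarith
  have h88 := herm2Real_nonneg_of_psd (a := 88) (b := 24) (x := 8) (by norm_num) (by norm_num) (by norm_num) ι₁ ι₂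
  have h84 := herm2Real_nonneg_of_psd (a := 84) (b := 20) (x := 12) (by norm_num) (by norm_num) (by norm_num) ι₁ ι₂
  intro p hp
  refine le_trans ?_ (firstOrderValue_oneSided_ge_gain hG₁ hG₂ p hp)
  have : (0 : ℝ) + (-(4 * τ₀ * π) * Complex.normSq ι₁ + -(4 * τ₀ * π) * Complex.normSq ι₂ +
      2 * (4 * τ₀ * π) * (conj ι₁ * ι₂).re) + (1 + τ₀) / (2 * π) *
      (176 * π ^ 2 * Complex.normSq ι₁ + 48 * π ^ 2 * Complex.normSq ι₂ + 2 * (16 * π ^ 2) * (conj ι₁ * ι₂).re) =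
      π * ((88 * Complex.normSq ι₁ + 24 * Complex.normSq ι₂ + 2 * 8 * (conj ι₁ * ι₂).re) +
        τ₀ * (84 * Complex.normSq ι₁ + 20 * Complex.normSq ι₂ + 2 * 12 * (conj ι₁ * ι₂).re)) := by
    field_simp
    ring
  rw [this]
  have : 0 ≤ τ₀ * (84 * Complex.normSq ι₁ + 20 * Complex.normSq ι₂ + 2 * 12 * (conj ι₁ * ι₂).re) :=
    mul_nonneg hτ h84
  have : 0 ≤ (88 * Complex.normSq ι₁ + 24 * Complex.normSq ι₂ + 2 * 8 * (conj ι₁ * ι₂).re) +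
      τ₀ * (84 * Complex.normSq ι₁ + 20 * Complex.normSq ι₂ + 2 * 12 * (conj ι₁ * ι₂).re) := by linarith
  positivity

/-- **inf over `𝓜` = the model-corner form** (matrix version of deriv-1 (5.2)): every datum of the one-sided box has
value `≥ π·([[88,8],[8,24]] + τ₀[[84,12],[12,20]])(ι)`. [cite: Zhang2022LandauSiegel, §2 Lemma 2.3, (2.13), (2.32)] -/
theorem k0Plane_inf (τ₀ l₁ : ℝ) (ι₁ ι₂ : ℂ) :
    ∀ p ∈ Icc l₁ 0 ×ˢ Ici ((1 + τ₀) / (2 * π)),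
      π * ((88 * Complex.normSq ι₁ + 24 * Complex.normSq ι₂ + 2 * 8 * (conj ι₁ * ι₂).re) +
        τ₀ * (84 * Complex.normSq ι₁ + 20 * Complex.normSq ι₂ + 2 * 12 * (conj ι₁ * ι₂).re)) ≤
      firstOrderValue 0
        (-(4 * τ₀ * π) * Complex.normSq ι₁ + -(4 * τ₀ * π) * Complex.normSq ι₂ + 2 * (4 * τ₀ * π) * (conj ι₁ * ι₂).re)
        (-(32 * π) * Complex.normSq ι₁ + -(32 * π) * Complex.normSq ι₂ + 2 * (32 * π) * (conj ι₁ * ι₂).re)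
        (176 * π ^ 2 * Complex.normSq ι₁ + 48 * π ^ 2 * Complex.normSq ι₂ + 2 * (16 * π ^ 2) * (conj ι₁ * ι₂).re)
        p := by
  have hS := k0Plane_S_value ι₁ ι₂
  have hSnn : 0 ≤ Complex.normSq (ι₁ - ι₂) := Complex.normSq_nonneg _
  have hG₁ : -(32 * π) * Complex.normSq ι₁ + -(32 * π) * Complex.normSq ι₂ + 2 * (32 * π) * (conj ι₁ * ι₂).re ≤ 0 := by
    nlinarith [pi_pos]
  have hG₂ : 0 ≤ 176 * π ^ 2 * Complex.normSq ι₁ + 48 * π ^ 2 * Complex.normSq ι₂ +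
      2 * (16 * π ^ 2) * (conj ι₁ * ι₂).re := by
    have := herm2Real_nonneg_of_psd (a := 176) (b := 48) (x := 16) (by norm_num) (by norm_num) (by norm_num) ι₁ ι₂
    have hπ : 0 < π ^ 2 := by positivity
    nlinarith
  intro p hp
  have e' : (0 : ℝ) + (-(4 * τ₀ * π) * Complex.normSq ι₁ + -(4 * τ₀ * π) * Complex.normSq ι₂ +
      2 * (4 * τ₀ * π) * (conj ι₁ * ι₂).re) + (1 + τ₀) / (2 * π) *
      (176 * π ^ 2 * Complex.normSq ι₁ + 48 * π ^ 2 * Complex.normSq ι₂ + 2 * (16 * π ^ 2) * (conj ι₁ * ι₂).re) =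
      π * ((88 * Complex.normSq ι₁ + 24 * Complex.normSq ι₂ + 2 * 8 * (conj ι₁ * ι₂).re) +
        τ₀ * (84 * Complex.normSq ι₁ + 20 * Complex.normSq ι₂ + 2 * 12 * (conj ι₁ * ι₂).re)) := by
    field_simp
    ring
  exact le_trans (le_of_eq e'.symm) (firstOrderValue_oneSided_ge_gain hG₁ hG₂ p hp)

/-- **No robust first-order closing anywhere on the plane**: for every design `ι` and every admissible box `M`
containing a model datum `(λ₀, c₀)` (`l₁ ≤ λ₀ ≤ 0`, `c₀ ≥ c′_det(τ₀)`), `¬ ClosesFirstOrderOn M`.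
[cite: Zhang2022LandauSiegel, §2 Lemma 2.3, (2.13), (2.32)] -/
theorem not_closesFirstOrderOn_k0Plane {τ₀ l₁ lam₀ c₀ : ℝ} {M : Set (ℝ × ℝ)} (hτ : 0 ≤ τ₀)
    (hl : l₁ ≤ lam₀) (hl' : lam₀ ≤ 0) (hc₀ : (1 + τ₀) / (2 * π) ≤ c₀) (hM : (lam₀, c₀) ∈ M) (ι₁ ι₂ : ℂ) :
    ¬ ClosesFirstOrderOn M 0
      (-(4 * τ₀ * π) * Complex.normSq ι₁ + -(4 * τ₀ * π) * Complex.normSq ι₂ + 2 * (4 * τ₀ * π) * (conj ι₁ * ι₂).re)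
      (-(32 * π) * Complex.normSq ι₁ + -(32 * π) * Complex.normSq ι₂ + 2 * (32 * π) * (conj ι₁ * ι₂).re)
      (176 * π ^ 2 * Complex.normSq ι₁ + 48 * π ^ 2 * Complex.normSq ι₂ + 2 * (16 * π ^ 2) * (conj ι₁ * ι₂).re) :=
  not_closesFirstOrderOn_of_mem (modelConsistentOn_k0Plane l₁ hτ ι₁ ι₂)
    (Set.mk_mem_prod (Set.mem_Icc.mpr ⟨hl, hl'⟩) (Set.mem_Ici.mpr hc₀)) hM

/-! ### The crude symmetric `λ`-box on the plane: PSD up to `|λ| ≤ ½`, SHARP at `τ₀ = 0` -/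

/-- **Symmetric box `|λ| ≤ ½` passes on the plane** (every `τ₀ ≥ 0`): bottom corners
`H(−½, c′_det) = π([[104,−8],[−8,40]] + τ₀[[84,12],[12,20]])` and `H(+½, c′_det) = π([[72,24],[24,8]] + τ₀[[84,12],[12,20]])`
are PSD (`72·8 = 24²`: the `τ₀ = 0` corner is singular), and `G₂ ⪰ 0` extends up the half-strip.
[cite: Zhang2022LandauSiegel, §2 Lemma 2.3, (2.13), (2.32)] -/
theorem modelConsistentOn_k0Plane_symm {τ₀ : ℝ} (hτ : 0 ≤ τ₀) (ι₁ ι₂ : ℂ) :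
    ModelConsistentOn (Icc (-(1 / 2)) (1 / 2) ×ˢ Ici ((1 + τ₀) / (2 * π))) 0
      (-(4 * τ₀ * π) * Complex.normSq ι₁ + -(4 * τ₀ * π) * Complex.normSq ι₂ + 2 * (4 * τ₀ * π) * (conj ι₁ * ι₂).re)
      (-(32 * π) * Complex.normSq ι₁ + -(32 * π) * Complex.normSq ι₂ + 2 * (32 * π) * (conj ι₁ * ι₂).re)
      (176 * π ^ 2 * Complex.normSq ι₁ + 48 * π ^ 2 * Complex.normSq ι₂ + 2 * (16 * π ^ 2) * (conj ι₁ * ι₂).re) := by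
  have hG₂ : 0 ≤ 176 * π ^ 2 * Complex.normSq ι₁ + 48 * π ^ 2 * Complex.normSq ι₂ +
      2 * (16 * π ^ 2) * (conj ι₁ * ι₂).re := by
    have := herm2Real_nonneg_of_psd (a := 176) (b := 48) (x := 16) (by norm_num) (by norm_num) (by norm_num) ι₁ ι₂
    have hπ : 0 < π ^ 2 := by positivity
    nlinarith
  have h84 := herm2Real_nonneg_of_psd (a := 84) (b := 20) (x := 12) (by norm_num) (by norm_num) (by norm_num) ι₁ ι₂
  have h72 := herm2Real_nonneg_of_psd (a := 72) (b := 8) (x := 24) (by norm_num) (by norm_num) (by norm_num) ι₁ ι₂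
  have h104 := herm2Real_nonneg_of_psd (a := 104) (b := 40) (x := -8) (by norm_num) (by norm_num) (by norm_num) ι₁ ι₂
  have hτ84 : 0 ≤ τ₀ * (84 * Complex.normSq ι₁ + 20 * Complex.normSq ι₂ + 2 * 12 * (conj ι₁ * ι₂).re) :=
    mul_nonneg hτ h84
  refine modelConsistentOn_halfStrip_of_ends hG₂ ?_ ?_
  · -- λ = −½
    have e : firstOrderValue 0
        (-(4 * τ₀ * π) * Complex.normSq ι₁ + -(4 * τ₀ * π) * Complex.normSq ι₂ + 2 * (4 * τ₀ * π) * (conj ι₁ * ι₂).re)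
        (-(32 * π) * Complex.normSq ι₁ + -(32 * π) * Complex.normSq ι₂ + 2 * (32 * π) * (conj ι₁ * ι₂).re)
        (176 * π ^ 2 * Complex.normSq ι₁ + 48 * π ^ 2 * Complex.normSq ι₂ + 2 * (16 * π ^ 2) * (conj ι₁ * ι₂).re)
        (-(1 / 2), (1 + τ₀) / (2 * π)) =
        π * ((104 * Complex.normSq ι₁ + 40 * Complex.normSq ι₂ + 2 * (-8) * (conj ι₁ * ι₂).re) +
          τ₀ * (84 * Complex.normSq ι₁ + 20 * Complex.normSq ι₂ + 2 * 12 * (conj ι₁ * ι₂).re)) := by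
      simp only [firstOrderValue]; field_simp; ring
    rw [e]
    have : 0 ≤ (104 * Complex.normSq ι₁ + 40 * Complex.normSq ι₂ + 2 * (-8) * (conj ι₁ * ι₂).re) +
        τ₀ * (84 * Complex.normSq ι₁ + 20 * Complex.normSq ι₂ + 2 * 12 * (conj ι₁ * ι₂).re) := by linarith
    positivity
  · -- λ = +½
    have e : firstOrderValue 0
        (-(4 * τ₀ * π) * Complex.normSq ι₁ + -(4 * τ₀ * π) * Complex.normSq ι₂ + 2 * (4 * τ₀ * π) * (conj ι₁ * ι₂).re)
        (-(32 * π) * Complex.normSq ι₁ + -(32 * π) * Complex.normSq ι₂ + 2 * (32 * π) * (conj ι₁ * ι₂).re)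
        (176 * π ^ 2 * Complex.normSq ι₁ + 48 * π ^ 2 * Complex.normSq ι₂ + 2 * (16 * π ^ 2) * (conj ι₁ * ι₂).re)
        (1 / 2, (1 + τ₀) / (2 * π)) =
        π * ((72 * Complex.normSq ι₁ + 8 * Complex.normSq ι₂ + 2 * 24 * (conj ι₁ * ι₂).re) +
          τ₀ * (84 * Complex.normSq ι₁ + 20 * Complex.normSq ι₂ + 2 * 12 * (conj ι₁ * ι₂).re)) := by
      simp only [firstOrderValue]; field_simp; ring
    rw [e]
    have : 0 ≤ (72 * Complex.normSq ι₁ + 8 * Complex.normSq ι₂ + 2 * 24 * (conj ι₁ * ι₂).re) +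
        τ₀ * (84 * Complex.normSq ι₁ + 20 * Complex.normSq ι₂ + 2 * 12 * (conj ι₁ * ι₂).re) := by linarith
    positivity

/-- **SHARPNESS at `τ₀ = 0`: the null design of the singular corner.**  At `(λ, c′) = (½, c′_det(0))` the design
`ι = (1, −3)` (`u = e₁ − 3e₂ = k₁ − 2k₂ − 3k₃`) has first-order value EXACTLY `0` (obj-eng-1 22:10:01Z: `H/π = [[72,24],[24,8]]`,
`det = 0`, null vector `(1, −3)`). [cite: Zhang2022LandauSiegel, §2 Lemma 2.3, (2.13), (2.32)] -/
theorem k0Plane_sheet0_symmCorner_null :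
    firstOrderValue 0
        (-(4 * (0 : ℝ) * π) * Complex.normSq (1 : ℂ) + -(4 * (0 : ℝ) * π) * Complex.normSq (-3 : ℂ) +
          2 * (4 * (0 : ℝ) * π) * (conj (1 : ℂ) * (-3 : ℂ)).re)
        (-(32 * π) * Complex.normSq (1 : ℂ) + -(32 * π) * Complex.normSq (-3 : ℂ) +
          2 * (32 * π) * (conj (1 : ℂ) * (-3 : ℂ)).re)
        (176 * π ^ 2 * Complex.normSq (1 : ℂ) + 48 * π ^ 2 * Complex.normSq (-3 : ℂ) +
          2 * (16 * π ^ 2) * (conj (1 : ℂ) * (-3 : ℂ)).re)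
        (1 / 2, (1 + 0) / (2 * π)) = 0 := by
  simp only [firstOrderValue, map_one, one_mul, Complex.normSq_neg, Complex.neg_re]
  have h3 : Complex.normSq (3 : ℂ) = 9 := by
    rw [show (3 : ℂ) = ((3 : ℝ) : ℂ) by norm_num, Complex.normSq_ofReal]; norm_num
  have h3' : (3 : ℂ).re = 3 := by
    rw [show (3 : ℂ) = ((3 : ℝ) : ℂ) by norm_num, Complex.ofReal_re]
  rw [h3, h3']
  field_simp
  ring

/-- **SHARPNESS: any wider symmetric `λ`-box fails on the plane at `τ₀ = 0`.**  For `Λ > ½` the design `ι = (1, −3)` has a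
NEGATIVE value at the admissible datum `(Λ, c′_det(0)) = (Λ, 1/(2π))` (value `= 256π(1 − 2Λ)`), so it is not
model-consistent on `[−Λ, Λ] × [c′_det(0), ∞)`.  The three named vectors do not see this (their symmetric margins at
`τ₀ = 0` are `32π, 72π, 8π`): the plane form is strictly stronger; the word uses the ONE-SIDED box (deriv-1 §6).
[cite: Zhang2022LandauSiegel, §2 Lemma 2.3, (2.13), (2.32)] -/
theorem not_modelConsistentOn_k0Plane_symm_of_gt_half {Λ : ℝ} (hΛ : 1 / 2 < Λ) :
    ¬ ModelConsistentOn (Icc (-Λ) Λ ×ˢ Ici ((1 + 0) / (2 * π))) 0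
        (-(4 * (0 : ℝ) * π) * Complex.normSq (1 : ℂ) + -(4 * (0 : ℝ) * π) * Complex.normSq (-3 : ℂ) +
          2 * (4 * (0 : ℝ) * π) * (conj (1 : ℂ) * (-3 : ℂ)).re)
        (-(32 * π) * Complex.normSq (1 : ℂ) + -(32 * π) * Complex.normSq (-3 : ℂ) +
          2 * (32 * π) * (conj (1 : ℂ) * (-3 : ℂ)).re)
        (176 * π ^ 2 * Complex.normSq (1 : ℂ) + 48 * π ^ 2 * Complex.normSq (-3 : ℂ) +
          2 * (16 * π ^ 2) * (conj (1 : ℂ) * (-3 : ℂ)).re) := by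
  intro h
  have hmem : (Λ, (1 + 0) / (2 * π)) ∈ Icc (-Λ) Λ ×ˢ Ici ((1 + (0 : ℝ)) / (2 * π)) :=
    Set.mk_mem_prod (Set.mem_Icc.mpr ⟨by linarith, le_rfl⟩) Set.self_mem_Ici
  have hv := h _ hmem
  simp only [firstOrderValue, map_one, one_mul, Complex.normSq_neg, Complex.neg_re] at hv
  have h3 : Complex.normSq (3 : ℂ) = 9 := by
    rw [show (3 : ℂ) = ((3 : ℝ) : ℂ) by norm_num, Complex.normSq_ofReal]; norm_num
  have h3' : (3 : ℂ).re = 3 := by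
    rw [show (3 : ℂ) = ((3 : ℝ) : ℂ) by norm_num, Complex.ofReal_re]
  rw [h3, h3'] at hv
  have e : (0 : ℝ) + (-(4 * 0 * π) * 1 + -(4 * 0 * π) * 9 + 2 * (4 * 0 * π) * -3) +
      Λ * (-(32 * π) * 1 + -(32 * π) * 9 + 2 * (32 * π) * -3) +
      (1 + 0) / (2 * π) * (176 * π ^ 2 * 1 + 48 * π ^ 2 * 9 + 2 * (16 * π ^ 2) * -3) = 256 * π * (1 - 2 * Λ) := by
    field_simp; ring
  rw [e] at hv
  have : 256 * π * (1 - 2 * Λ) < 0 := by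
    have : 1 - 2 * Λ < 0 := by linarith
    nlinarith [pi_pos]
  linarith

end Literature.NumberTheory.LFunctions.Zhang2022.EllRegime

end
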